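import Summits.BirchSwinnertonDyer.BirchSwinnertonDyer.Theorems.QuadraticBranchSignedControlPlusEtaLowerInclusionManinInput
import Summits.BirchSwinnertonDyer.BirchSwinnertonDyer.Theorems.QuadraticBranchSignedControlPlusEtaLowerInclusionKuriharaCut
import HarnessLib

/-!
# Route `QuadraticBranchSignedControl` (rung K8, cell `bsd-potss`), crux `PlusEtaLowerInclusion`
# (item stmt-BirchSwinnertonDyer-19601): THE KURIHARA CUT, MANIN-FREE — the crux BY NAME from
# Kim 1.11_η + four published Manin-constant facts + Kurihara's conjecture mod `p` on the
# Tamagawa-free tower-onto partners + the Tamagawa rows (a `--supports` file; seat `bsd-potss-k8eta-c1`, gen 9)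

HONEST FRAMING (cell `bsd-potss`, run/shared/lean/pub/bsd-potss/; FULL-BSD rank ≤ 1 programme,
tranche 1b, HUMAN RULING D-0036/D-0074; verbatim in every file): the target of record is FULL BSD for
every analytic-rank ≤ 1 curve over `ℚ`; this cell attacks rows B4/B5/B8 (additive potentially
supersingular primes). Crux 19601 `PlusEtaLowerInclusion` — Kobayashi's Eisenstein (lower) inclusion
of the even main conjecture at `η = ω^{(p−1)/2}` for every good supersingular `a_p(V) = 0` twist `V/ℚ`,
`p ≥ 5`, whose `p`-adic tower is onto = Kato's lower IMC inclusion for the ADDITIVE partner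
`W = V ⊗ χ_{p*}` — is OPEN class-wide and in print for no non-CM `V`. THIS FILE closes nothing, books
nothing and claims `BSD(W, p)` for no pair.

WHAT. The companion `…PlusEtaLowerInclusionManinInput.lean` proves, modulo the four named
Manin-constant facts `hM` (Mazur 1978 Cor. 4.1), `hAU` (Abbes–Ullmo 1996 Thm. A), `hC2` (Česnavičius
2018 Thm. 1.2), `hnf` (modularity): `p ∤ c₀` for the lattice-optimal datum of every globally minimal
curve isogenous to a K8 partner (Stevens' twisting argument, tree theorem), and the isogeny transport of
a datum with `p ∤ c`. Here:

* §4 `maninInput_of_quadraticBranch`: the (K2a) binder `hManin` of the Kurihara cut (p599308 §3: a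
  parametrisation datum with `p ∤ c` and a `p`-unit period transfer on EVERY tower-onto Gss2 partner)
  is a THEOREM modulo `hM hAU hC2 hnf` (period: Greenberg–Vatsal 2000 Remark 3.4, tree theorem
  `SkinnerUrban2014.exists_unit_mul_plusPeriod_of_irreducible_anyPrime`).

* §5 `plusEtaLowerInclusion_of_kim111_of_maninFacts_of_kuriharaUnit_of_tamagawaRows`:
  **`PlusEtaLowerInclusion` ⟸ (K1) Kim 1.11_η + (M) `hM hAU hC2 hnf` + (K2b) for EVERY datum `D` of a
  Tamagawa-`p`-free tower-onto partner a cyclic `𝒩₁`-level with a unit Kurihara number of `D.f`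
  (Kurihara's conjecture mod `p`, Kim Conj. 1.9 — Σ₁ per pair; 3098/3098 computed Tamagawa-free rows
  carry a witness) + (K3) (E⁺_η) on the Tamagawa rows** — p599308 §3 with `hManin` discharged.
* §6 `kuriharaData_of_maninFacts_of_kuriharaUnit`: the statement REGISTERED as the skeleton-v5 stub
  `stub_etaLower_kurihara_tamFree` (= the merged Σ₁ datum `hKur` of p599308 §2, reproduced verbatim as
  the conclusion) from (M) + (K2b) — so the stub's OPEN content is its Kurihara half alone (a reduction
  for the planner to register, not a by-name closer); and `etaPair_of_kim111_of_maninFacts_of_kuriharaUnit`: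
  per `V` on the Tamagawa-free sub-locus, (E⁺_η) ∧ (C1⁺_η) from (K1) + (M) + (K2b) at that pair.

READING FOR THE PLANNER. The why_might_fail clause of `stub_etaLower_kurihara_tamFree` «`p ∣ c` for an
optimal curve at a prime of additive reduction (open beyond Cremona's range)» is RETIRED: at the K8
partners (type `I₀*`, odd `p`) `p ∤ c_opt` is print (Stevens 1989 + Mazur 1978 + Česnavičius 2018) and a
tree theorem, and the transfer to non-optimal partners is §3 of the companion. What remains open in the
stub is Kurihara's conjecture mod `p` for the Tamagawa-`p`-free partners (⟺ Kato's IMC for `W` there,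
Kim Thm. 1.11), plus (K3) and the named fact (K1).

HONEST LABEL: CONDITIONAL closers (displayed hypotheses, (K1) a named Literature fact read at `η` through
the flagged zeta-line identification, (M) four named Literature facts); (K2b) and (K3) are OPEN
class-wide; nothing is booked; no census row moves; BSD is not proved by any of this.

References: [Kim2022StructureSelmer] Thm. 1.11 (PDF p. 8), Conj. 1.9, §1.3.5, Remark 6.2;
[Stevens1989] Lemmas (5.2), (5.4); [Mazur1978] Cor. 4.1; [AbbesUllmo1996] Thm. A; [Cesnavicius2018]
Thm. 1.2; [Kobayashi2003] §4 Even main conjecture (p. 8), proof of Thm. 7.4 (p. 13);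
[Kato2004Asterisque] Conj. 12.10.
-/

set_option autoImplicit false
-- sibling precedent (`…PlusEtaLowerInclusionKuriharaCut.lean`): the directory name repeats the summit name
set_option linter.dupNamespace false

noncomputable section

open scoped Classical MatrixGroups ModularForm

namespace Summit.BirchSwinnertonDyer.BirchSwinnertonDyer.Theorems.PlusEtaManinInput

open CongruenceSubgroup WeierstrassCurve IsDedekindDomain Rat.HeightOneSpectrum
  Literature.NumberTheory.EllipticCurves
  Literature.NumberTheory.EllipticCurves.ModularForms
  Literature.NumberTheory.EllipticCurves.Rank1Residual
  Literature.NumberTheory.Automorphic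
  Summit.BirchSwinnertonDyer.Rank1Residual
  Summit.BirchSwinnertonDyer.BirchSwinnertonDyer.Theorems
  Summit.BirchSwinnertonDyer.BirchSwinnertonDyer.Theses.QuadraticBranchSignedControl

open Summit.BirchSwinnertonDyer.Rank1Residual.Additive hiding EtaSignedSelmerDualData
  IsQuadraticBranchPlusLFunction IsQuadraticBranchMinusLFunction

/-! ## §4 THE MANIN INPUT (K2a) OF THE KURIHARA CUT, DISCHARGED CLASS-WIDE -/

/-- **(K2a) `hManin` of the Kurihara cut is a THEOREM.** Modulo Mazur 1978 Cor. 4.1 (`hM`),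
Abbes–Ullmo 1996 Thm. A (`hAU`), Česnavičius 2018 Thm. 1.2 (`hC2`) and modularity (`hnf`): for EVERY
globally minimal partner `W` of a K8 pair — `p` an odd prime, `V/ℚ` globally minimal and good at `p`,
`C • W^{(p*)} = V`, `ρ̄_{W,p}` onto — there is a modular parametrisation datum `D` of `W` (at level
`N(W)`) with **`p ∤ c(D)`** and a **`p`-adic unit `u` with `Ω(W) = u · Ω⁺_{D.f}`** — verbatim the binder
`hManin` of `PlusEtaKuriharaCut.plusEtaLowerInclusion_of_kim111_of_maninUnit_of_kuriharaUnit_of_tamagawaRows`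
(p599308 §3). Proof: the optimal member `(W₀, D₀)` of the class exists from the newform
(`exists_optimal_modularParametrizationData_of_isNewformOf'`, lattice-optimal by
`latticeEq_of_forall_modularDegree_le`); `p ∤ c₀` by §2; transport to `W` by §3 (`ρ̄` onto ⇒ irreducible
⇒ an isogeny of degree prime to `p`); the period transfer is Greenberg–Vatsal's Remark 3.4
(`SkinnerUrban2014.exists_unit_mul_plusPeriod_of_irreducible_anyPrime`), its Manin binder discharged by
§2 on every lattice-optimal datum with newform `f` (isogenous to `W` by `isIsogenous_of_forall_mul_mem_lattice`,
from `c(D) Λ_{W₀'} = c₀' · c(D) Λ_f ⊆ Λ_W`). No conductor bound, no Cremona table, no optimality of `W`.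
[cite: Stevens1989, Lemmas (5.2), (5.4)] [cite: Mazur1978, Cor. 4.1] [cite: AbbesUllmo1996, Thm. A]
[cite: Cesnavicius2018, Thm. 1.2] [cite: GreenbergVatsal2000, §3, Remark 3.4]
[cite: Kim2022StructureSelmer, §1.3.5 and §1.4.1 (the Manin hypothesis of Thm. 1.11)] -/
theorem maninInput_of_quadraticBranch
    (hM : mazur_not_dvd_maninConstant_of_odd)
    (hAU : abbesUllmo_not_dvd_maninConstant_of_not_dvd_level)
    (hC2 : cesnavicius_not_two_dvd_maninConstant_of_two_dvd_level)
    (hnf : exists_isNewformOf)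
    {V : WeierstrassCurve ℚ} [V.IsElliptic] [V.IsGloballyMinimal]
    {W : WeierstrassCurve ℚ} [W.IsElliptic] [W.IsGloballyMinimal]
    (C : VariableChange ℚ) (p : ℕ) [hp : Fact p.Prime] (hp2 : p ≠ 2)
    (hCV : C • W.quadraticTwist ((-1) ^ (p / 2) * p) = V) (hgood : V.HasGoodReductionAtPrime p)
    (hsurj : W.HasSurjectiveModNGaloisRep p) :
    ∃ (NW : ℕ) (_ : NeZero NW) (D : ModularParametrizationData W NW),
      ¬ (p : ℤ) ∣ D.maninConstant ∧
      ∃ u : ℚ, ‖(u : ℚ_[p])‖ = 1 ∧ W.realPeriodRat = u * plusPeriod D.f := by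
  haveI : NeZero (W.conductorNorm ℤ) := ⟨(WeierstrassCurve.conductorNorm_pos_holds W).ne'⟩
  haveI : NeZero (p : ℚ) := ⟨Nat.cast_ne_zero.mpr hp.out.ne_zero⟩
  have hirr : W.HasIrreducibleModPGaloisRep p :=
    hasIrreducibleModPGaloisRep_of_hasSurjectiveModNGaloisRep W p (by exact_mod_cast hsurj)
  obtain ⟨f, hf⟩ := hnf W
  -- the optimal member of the class and its lattice-optimal datum
  obtain ⟨W₀, _, _, D₀, hf₀, hiso, hmin⟩ :=
    exists_optimal_modularParametrizationData_of_isNewformOf' (W.conductorNorm ℤ) W rfl hf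
  have hopt₀ : ∀ z ∈ D₀.L.lattice, ∃ w ∈ periodLattice D₀.f, z = D₀.c * w :=
    D₀.latticeEq_of_forall_modularDegree_le (fun W₂ _ D₂ h₂ ↦ hmin W₂ D₂ (h₂.trans hf₀))
  have hc₀ : ¬ (p : ℤ) ∣ D₀.maninConstant :=
    not_dvd_maninConstant_of_quadraticBranch_of_isogenous_latticeOptimal hM hAU hC2 hnf C p hp2 hCV
      hgood hiso D₀ hopt₀
  -- transport to `W`
  obtain ⟨D, hDf, hDc⟩ :=
    exists_modularParametrizationData_not_dvd_of_isogenous hf p hirr hiso D₀ hf₀ hc₀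
  -- the period transfer (Greenberg–Vatsal Remark 3.4), Manin binder discharged by §2
  have hper : ∃ u : ℚ, ‖(u : ℚ_[p])‖ = 1 ∧ W.realPeriodRat = u * plusPeriod f := by
    refine SkinnerUrban2014.exists_unit_mul_plusPeriod_of_irreducible_anyPrime W p hirr f hf ?_
    intro W₀' _ _ D₀' hf₀' hopt₀'
    -- `W₀'` is isogenous to `W`: `c(D) Λ_{W₀'} ⊆ Λ_W`
    have hle : ∀ z ∈ D₀'.L.lattice, ((D.c : ℚ) : ℂ) * z ∈ D.L.lattice := by
      intro z hz
      obtain ⟨w, hw, rfl⟩ := hopt₀' z hz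
      have hw' : w ∈ periodLattice D.f := by rw [hDf, ← hf₀']; exact hw
      have h1 : (D.c : ℂ) * w ∈ D.L.lattice := D.smul_periodLattice_le w hw'
      have e : ((D.c : ℚ) : ℂ) * ((D₀'.c : ℂ) * w) = (D₀'.c : ℤ) • ((D.c : ℂ) * w) := by
        rw [zsmul_eq_mul]; push_cast; ring
      rw [e]
      exact zsmul_mem h1 _
    have hDc0 : (D.c : ℚ) ≠ 0 := by
      have : D.c ≠ 0 := fun h ↦ hDc (by change (p : ℤ) ∣ D.c; rw [h]; exact dvd_zero _)
      exact_mod_cast this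
    have hiso' : IsIsogenous W W₀' :=
      (isIsogenous_of_forall_mul_mem_lattice D₀'.isNeronLattice.1 D₀'.isNeronLattice.2
        D.isNeronLattice.1 D.isNeronLattice.2 hDc0 hle).symm_of_isElliptic
    exact not_dvd_maninConstant_of_quadraticBranch_of_isogenous_latticeOptimal hM hAU hC2 hnf C p hp2
      hCV hgood hiso' D₀' hopt₀'
  refine ⟨W.conductorNorm ℤ, inferInstance, D, hDc, ?_⟩
  rw [hDf]
  exact hper

/-! ## §5 THE KURIHARA CUT WITH THE MANIN INPUT DISCHARGED: the crux BY NAME from Kim 1.11_η + four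
## Manin-constant facts + Kurihara's conjecture mod `p` on the Tamagawa-free partners + the Tamagawa rows -/

/-- **THE KURIHARA CUT OF CRUX 19601, MANIN-FREE FORM.** `PlusEtaLowerInclusion` follows from
(K1) `hKim` — Kim 2026 Thm. 1.11 (1) ⟹ (3) at `η` (named fact, hypothesis position);
(M) FOUR PUBLISHED MANIN-CONSTANT FACTS `hM`, `hAU`, `hC2`, `hnf` (Mazur 1978 Cor. 4.1, Abbes–Ullmo
  1996 Thm. A, Česnavičius 2018 Thm. 1.2, modularity) — replacing the (K2a) binder «a parametrisation
  datum with `p ∤ c` and a `p`-unit period transfer on every tower-onto partner», now §4's THEOREM;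
(K2b) `hKur` — for EVERY parametrisation datum `D` of a Tamagawa-`p`-free tower-onto partner, a cyclic
  `𝒩₁`-level with a unit Kurihara number of `D.f`: KURIHARA'S CONJECTURE MOD `p` verbatim (Kim Conj. 1.9;
  Σ₁ per pair; 3098/3098 computed Tamagawa-free rows carry a witness);
(K3) `hTam` — (E⁺_η) on the Tamagawa rows.
One line over p599308 §3 with `hManin := maninInput_of_quadraticBranch` (`ρ̄_{W,p}` onto from the
tower at `m = 1`, transported along the twist). So the registered stub `stub_etaLower_kurihara_tamFree`
(skeleton v5) has OPEN content = Kurihara's conjecture mod `p` ALONE; its Manin half is print.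
CONDITIONAL (displayed hypotheses); closes nothing by itself; nothing booked.
[cite: Kim2022StructureSelmer, Thm. 1.11 (PDF p. 8), Conj. 1.9, §1.3.5, Remark 6.2]
[cite: Stevens1989, Lemmas (5.2), (5.4)] [cite: Mazur1978, Cor. 4.1] [cite: Cesnavicius2018, Thm. 1.2]
[cite: Kobayashi2003, §4 Even main conjecture (p. 8), proof of Thm. 7.4 (p. 13)] -/
theorem plusEtaLowerInclusion_of_kim111_of_maninFacts_of_kuriharaUnit_of_tamagawaRows
    (hKim : Kim2026.thm111_etaEisensteinInclusion_of_kuriharaNumber_ne_zero)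
    (hM : mazur_not_dvd_maninConstant_of_odd)
    (hAU : abbesUllmo_not_dvd_maninConstant_of_not_dvd_level)
    (hC2 : cesnavicius_not_two_dvd_maninConstant_of_two_dvd_level)
    (hnf : exists_isNewformOf)
    (hKur : ∀ (V : WeierstrassCurve ℚ) [V.IsElliptic] [V.IsGloballyMinimal] (W : WeierstrassCurve ℚ)
      [W.IsElliptic] [W.IsGloballyMinimal] (C : VariableChange ℚ) (p : ℕ) [Fact p.Prime],
      5 ≤ p → C • W.quadraticTwist ((-1) ^ (p / 2) * p) = V → V.HasGoodReductionAtPrime p →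
      V.frobeniusTrace p = 0 → (∀ m : ℕ, V.HasSurjectiveModNGaloisRep (p ^ m : ℕ)) →
      ¬ p ∣ W.tamagawaProduct →
      ∀ {NW : ℕ} [NeZero NW] (D : ModularParametrizationData W NW),
        ∃ (n : ℕ) (_ : NeZero n), Kato.IsKolyvaginProduct W p 1 n ∧
          (∀ (ℓ : ℕ) [Fact ℓ.Prime], ℓ ∣ n →
            Nat.card {P : ((WeierstrassCurve.integralModelInt W).map
              (Int.castRingHom (ZMod ℓ))).toAffine.Point // p • P = 0} ≤ p) ∧
          ∃ ψ : (ℓ : ℕ) → (ZMod ℓ)ˣ →* Multiplicative (ZMod p),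
            (∀ ℓ ∈ n.primeFactors, Function.Surjective (ψ ℓ)) ∧ kuriharaNumber D.f p n ψ ≠ 0)
    (hTam : ∀ (V : WeierstrassCurve ℚ) [V.IsElliptic] [V.IsGloballyMinimal] (W : WeierstrassCurve ℚ)
      [W.IsElliptic] [W.IsGloballyMinimal] (C : VariableChange ℚ) (p : ℕ) [Fact p.Prime],
      5 ≤ p → C • W.quadraticTwist ((-1) ^ (p / 2) * p) = V → V.HasGoodReductionAtPrime p →
      V.frobeniusTrace p = 0 → (∀ m : ℕ, V.HasSurjectiveModNGaloisRep (p ^ m : ℕ)) →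
      p ∣ W.tamagawaProduct → QuadraticBranchPlusEtaLowerInclusionAt V p) :
    PlusEtaLowerInclusion := by
  refine PlusEtaKuriharaCut.plusEtaLowerInclusion_of_kim111_of_maninUnit_of_kuriharaUnit_of_tamagawaRows
    hKim ?_ hKur hTam
  intro V _ _ W _ _ C p _ h5 hCV hgood _hap htower
  have hd : ((-1 : ℚ) ^ (p / 2) * p) ≠ 0 :=
    mul_ne_zero (pow_ne_zero _ (by norm_num)) (by exact_mod_cast (Fact.out : p.Prime).ne_zero)
  obtain ⟨C', hC'⟩ := exists_variableChange_twist_of_model_twist W hd hCV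
  have hsurj : W.HasSurjectiveModNGaloisRep p := by
    simpa only [pow_one] using
      (GaloisImage.hasSurjectiveModNGaloisRep_pow_iff_of_model_twist V p hd ⟨C', hC'⟩ 1).mpr (htower 1)
  exact maninInput_of_quadraticBranch hM hAU hC2 hnf C p (by omega) hCV hgood hsurj

/-! ## §6 The registered stub `stub_etaLower_kurihara_tamFree` (skeleton v5) from the Manin facts and
## Kurihara's conjecture mod `p` alone; the Tamagawa-free sub-locus per `V` -/

/-- **The Σ₁ stub of skeleton v5 reduced to its Kurihara half.** Modulo the four Manin-constant facts,
the statement registered as `stub_etaLower_kurihara_tamFree` (= the merged datum `hKur` of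
`PlusEtaKuriharaCut.plusEtaLowerInclusion_of_kim111_of_kuriharaData_of_tamagawaRows`, p599308 §2 —
reproduced VERBATIM as the conclusion) follows from (K2b) alone: Kurihara's conjecture mod `p` for every
parametrisation datum of every Tamagawa-`p`-free tower-onto partner. (Not a by-name closer of the stub —
that needs a spelled-out re-registration; this is the reduction the planner can register.)
[cite: Kim2022StructureSelmer, Conj. 1.9, §1.3.5] [cite: Stevens1989, Lemmas (5.2), (5.4)]
[cite: Cesnavicius2018, Thm. 1.2] [cite: Mazur1978, Cor. 4.1] -/
theorem kuriharaData_of_maninFacts_of_kuriharaUnit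
    (hM : mazur_not_dvd_maninConstant_of_odd)
    (hAU : abbesUllmo_not_dvd_maninConstant_of_not_dvd_level)
    (hC2 : cesnavicius_not_two_dvd_maninConstant_of_two_dvd_level)
    (hnf : exists_isNewformOf)
    (hKur : ∀ (V : WeierstrassCurve ℚ) [V.IsElliptic] [V.IsGloballyMinimal] (W : WeierstrassCurve ℚ)
      [W.IsElliptic] [W.IsGloballyMinimal] (C : VariableChange ℚ) (p : ℕ) [Fact p.Prime],
      5 ≤ p → C • W.quadraticTwist ((-1) ^ (p / 2) * p) = V → V.HasGoodReductionAtPrime p →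
      V.frobeniusTrace p = 0 → (∀ m : ℕ, V.HasSurjectiveModNGaloisRep (p ^ m : ℕ)) →
      ¬ p ∣ W.tamagawaProduct →
      ∀ {NW : ℕ} [NeZero NW] (D : ModularParametrizationData W NW),
        ∃ (n : ℕ) (_ : NeZero n), Kato.IsKolyvaginProduct W p 1 n ∧
          (∀ (ℓ : ℕ) [Fact ℓ.Prime], ℓ ∣ n →
            Nat.card {P : ((WeierstrassCurve.integralModelInt W).map
              (Int.castRingHom (ZMod ℓ))).toAffine.Point // p • P = 0} ≤ p) ∧
          ∃ ψ : (ℓ : ℕ) → (ZMod ℓ)ˣ →* Multiplicative (ZMod p),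
            (∀ ℓ ∈ n.primeFactors, Function.Surjective (ψ ℓ)) ∧ kuriharaNumber D.f p n ψ ≠ 0) :
    ∀ (V : WeierstrassCurve ℚ) [V.IsElliptic] [V.IsGloballyMinimal] (W : WeierstrassCurve ℚ)
      [W.IsElliptic] [W.IsGloballyMinimal] (C : VariableChange ℚ) (p : ℕ) [Fact p.Prime],
      5 ≤ p → C • W.quadraticTwist ((-1) ^ (p / 2) * p) = V → V.HasGoodReductionAtPrime p →
      V.frobeniusTrace p = 0 → (∀ m : ℕ, V.HasSurjectiveModNGaloisRep (p ^ m : ℕ)) →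
      ¬ p ∣ W.tamagawaProduct →
      ∃ (NW : ℕ) (_ : NeZero NW) (D : ModularParametrizationData W NW),
        ¬ (p : ℤ) ∣ D.maninConstant ∧
        (∃ u : ℚ, ‖(u : ℚ_[p])‖ = 1 ∧ W.realPeriodRat = u * plusPeriod D.f) ∧
        ∃ (n : ℕ) (_ : NeZero n), Kato.IsKolyvaginProduct W p 1 n ∧
          (∀ (ℓ : ℕ) [Fact ℓ.Prime], ℓ ∣ n →
            Nat.card {P : ((WeierstrassCurve.integralModelInt W).map
              (Int.castRingHom (ZMod ℓ))).toAffine.Point // p • P = 0} ≤ p) ∧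
          ∃ ψ : (ℓ : ℕ) → (ZMod ℓ)ˣ →* Multiplicative (ZMod p),
            (∀ ℓ ∈ n.primeFactors, Function.Surjective (ψ ℓ)) ∧ kuriharaNumber D.f p n ψ ≠ 0 := by
  intro V _ _ W _ _ C p _ h5 hCV hgood hap htower htam
  have hd : ((-1 : ℚ) ^ (p / 2) * p) ≠ 0 :=
    mul_ne_zero (pow_ne_zero _ (by norm_num)) (by exact_mod_cast (Fact.out : p.Prime).ne_zero)
  obtain ⟨C', hC'⟩ := exists_variableChange_twist_of_model_twist W hd hCV
  have hsurj : W.HasSurjectiveModNGaloisRep p := by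
    simpa only [pow_one] using
      (GaloisImage.hasSurjectiveModNGaloisRep_pow_iff_of_model_twist V p hd ⟨C', hC'⟩ 1).mpr (htower 1)
  obtain ⟨NW, _, D, hc, hper⟩ := maninInput_of_quadraticBranch hM hAU hC2 hnf C p (by omega) hCV hgood hsurj
  obtain ⟨n, _, hn, hcyc, ψ, hψ, hδ⟩ := hKur V W C p h5 hCV hgood hap htower htam D
  exact ⟨NW, inferInstance, D, hc, hper, n, inferInstance, hn, hcyc, ψ, hψ, hδ⟩

/-- **(E⁺_η) ∧ (C1⁺_η) on the Tamagawa-free tower-onto sub-locus, per `V`, from Kim 1.11_η + the four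
Manin facts + Kurihara's conjecture mod `p` at that pair.** For a globally minimal good supersingular
`a_p = 0` curve `V`, `p ≥ 5`, with onto `p`-adic tower and SOME globally minimal partner `W`
(`C • W^{(p*)} = V`) with `p ∤ ∏ c_ℓ(W)`: if every parametrisation datum of `W` has a unit Kurihara
number at a cyclic `𝒩₁`-level, then the Eisenstein inclusion AND the even main conjecture at `η` hold
at `(V, p)` (the road `PlusEtaKuriharaT0.etaPair_of_thm111_of_kuriharaUnit` with its Manin binders
discharged by §4). CONDITIONAL; per `V`; closes nothing; nothing booked.
[cite: Kim2022StructureSelmer, Thm. 1.11 (PDF p. 8), Conj. 1.9] [cite: Kobayashi2003, §4 (p. 8)]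
[cite: Stevens1989, Lemmas (5.2), (5.4)] [cite: Cesnavicius2018, Thm. 1.2] -/
theorem etaPair_of_kim111_of_maninFacts_of_kuriharaUnit
    (hKim : Kim2026.thm111_etaEisensteinInclusion_of_kuriharaNumber_ne_zero)
    (hM : mazur_not_dvd_maninConstant_of_odd)
    (hAU : abbesUllmo_not_dvd_maninConstant_of_not_dvd_level)
    (hC2 : cesnavicius_not_two_dvd_maninConstant_of_two_dvd_level)
    (hnf : exists_isNewformOf)
    (V : WeierstrassCurve ℚ) [V.IsElliptic] [V.IsGloballyMinimal] (p : ℕ) [Fact p.Prime]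
    (h5 : 5 ≤ p) (hgood : V.HasGoodReductionAtPrime p)
    (htower : ∀ m : ℕ, V.HasSurjectiveModNGaloisRep (p ^ m : ℕ))
    (W : WeierstrassCurve ℚ) [W.IsElliptic] [W.IsGloballyMinimal] (C : VariableChange ℚ)
    (hCV : C • W.quadraticTwist ((-1) ^ (p / 2) * p) = V) (htam : ¬ p ∣ W.tamagawaProduct)
    (hKur : ∀ {NW : ℕ} [NeZero NW] (D : ModularParametrizationData W NW),
        ∃ (n : ℕ) (_ : NeZero n), Kato.IsKolyvaginProduct W p 1 n ∧
          (∀ (ℓ : ℕ) [Fact ℓ.Prime], ℓ ∣ n →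
            Nat.card {P : ((WeierstrassCurve.integralModelInt W).map
              (Int.castRingHom (ZMod ℓ))).toAffine.Point // p • P = 0} ≤ p) ∧
          ∃ ψ : (ℓ : ℕ) → (ZMod ℓ)ˣ →* Multiplicative (ZMod p),
            (∀ ℓ ∈ n.primeFactors, Function.Surjective (ψ ℓ)) ∧ kuriharaNumber D.f p n ψ ≠ 0) :
    QuadraticBranchPlusEtaLowerInclusionAt V p ∧ QuadraticBranchPlusEtaMainConjectureAt V p := by
  have hd : ((-1 : ℚ) ^ (p / 2) * p) ≠ 0 :=
    mul_ne_zero (pow_ne_zero _ (by norm_num)) (by exact_mod_cast (Fact.out : p.Prime).ne_zero)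
  obtain ⟨C', hC'⟩ := exists_variableChange_twist_of_model_twist W hd hCV
  have hsurj : W.HasSurjectiveModNGaloisRep p := by
    simpa only [pow_one] using
      (GaloisImage.hasSurjectiveModNGaloisRep_pow_iff_of_model_twist V p hd ⟨C', hC'⟩ 1).mpr (htower 1)
  obtain ⟨NW, _, D, hc, hper⟩ := maninInput_of_quadraticBranch hM hAU hC2 hnf C p (by omega) hCV hgood hsurj
  obtain ⟨n, _, hn, hcyc, ψ, hψ, hδ⟩ := hKur D
  have h := PlusEtaKuriharaT0.etaPair_of_thm111_of_kuriharaUnit hKim W C hCV h5 hsurj htam D hc hper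
    n hn hcyc ψ hψ hδ
  exact ⟨h.1, h.2 htower⟩

end Summit.BirchSwinnertonDyer.BirchSwinnertonDyer.Theorems.PlusEtaManinInput

end
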